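import Literature.AlgebraicGeometry.ComplexMultiplication.CyclotomicFermatCMTypesTwoPowerLevelClassification
import Literature.AlgebraicGeometry.ComplexMultiplication.CyclotomicFermatCMTypesPrimePowerAllTriples
import Literature.AlgebraicGeometry.ComplexMultiplication.CyclotomicFermatCMTypesLevelPullback
import HarnessLib

/-!
# Koblitz–Rohrlich THEOREM 4 AS PRINTED — every `n` and every `m`: all coincidences `H_τ = H_{τ′}` modulo `2ⁿ` between triples of
# exact `2`-content `2ᵐ` (`n − m ≥ 4`)

Layer `Literature/AlgebraicGeometry/ComplexMultiplication`, namespace `…ComplexMultiplication.CyclotomicFermatCMType`; sequel of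
`CyclotomicFermatCMTypesTwoPowerLevelComplete` ∕ `…Classification` (the §5 Proposition = the `m = 0` ∕ g.c.d. `= 1` form of Theorem 4 for
every `n ≥ 4`, as an equivalence), of `CyclotomicFermatCMTypesLevelPullback` (§1's change of level `H_{(dr,ds,dt)} ↔ H_{(r,s,t)}`) and of
`CyclotomicFermatCMTypesPrimePowerAllTriples` §1 (its converse: equal pull-backs come from equal sets, any `d·M`); the `p = 2` counterpart
of `CyclotomicFermatCMTypesThreePowerLevelComplete` (Theorem 3 for every `m` at the product level `3ᵐ·3ᵏ`).  THEOREMS ONLY (no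
definition, no named fact, no `sorry`, no kernel `decide`).  The siblings' honest column: "Theorem 4's pairs with `m ≥ 1` … are
pull-backs from level `2ⁿ⁻¹` and outside these statements" — THIS FILE re-assembles the verbatim «for `0 ≤ m ≤ …`» statement.

THE SOURCE.  N. Koblitz, D. Rohrlich, *Simple factors in the Jacobian of a Fermat curve*, Canad. J. Math. **30** (1978) 1183–1205,
THEOREM 4 (p. 1186): "Suppose `N = 2ⁿ`. Then the only isogenies apart from the obvious ones are between pairs of lattices corresponding to
the triples a) `(2ᵐ, 2ⁿ⁻¹ − 2ᵐ⁺¹, 2ⁿ⁻¹ + 2ᵐ)` and `(2ᵐ⁺¹, 2ⁿ⁻² − 2ᵐ, 3(2ⁿ⁻²) − 2ᵐ)` for `0 ≤ m ≤ n − 3`, or b) [as a) in our copy], or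
c) `(2ᵐ, 2ᵐ, 2ⁿ − 2ᵐ⁺¹)` and `(2ᵐ⁺¹, 2ⁿ⁻¹ − 2ᵐ, 2ⁿ⁻¹ − 2ᵐ)` for `0 ≤ m ≤ n − 2`, or d) `(2ᵐ, 3(2ᵐ), 2ⁿ − 2ᵐ⁺²)` and
`(2ⁿ⁻¹ − 2ᵐ, 2ⁿ⁻¹ − 2ᵐ⁺¹, 3(2ᵐ))` for `0 ≤ m ≤ n − 4`, or e) `(2ᵐ, 2ⁿ⁻¹, 2ⁿ⁻¹ − 2ᵐ)` and `(2ᵐ, 2ᵐ, 2ⁿ − 2ᵐ⁺¹)` for `0 ≤ m ≤ n − 2`.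
Furthermore, a lattice of type a)ₘ is isogenous to the product of two lattices of type e)ₘ₊₁."; §1 (pp. 1183–1184): "let `M` be the
integer defined by `N/M = g.c.d.(N, r, s)` … `H_{r,s}` … subset of `(ℤ/Mℤ)*` … `L_{r,s}` as the lattice in `ℂ^{φ(M)/2}`"; §5 Proposition
(p. 1200, the case g.c.d. `= 1`, `n ≥ 4`).

## What is proved (level `N = 2ᵐ·2ᵏ`, `n = m + k`; entries given as natural numbers `r, …, t′` and triples `τ = (2ᵐr, 2ᵐs, 2ᵐt)`,
## `τ′ = (2ᵐr′, 2ᵐs′, 2ᵐt′)` modulo `N`)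

* **`perm_or_exceptional_of_fermatCMType_eq_twoPow_mul` — THEOREM 4 AS PRINTED**: for `k ≥ 4`, `r, …, t′` non-zero modulo `2ᵏ` with
  `r + s + t ≡ 0 ≡ r′ + s′ + t′` and one of them odd (exact `2`-content `2ᵐ`), `H_{τ′} = H_τ` modulo `N` ⟹ `{τ′} = {τ}`, or for a unit `w`
  of `ℤ/N` the pair `(wτ, wτ′)` is, up to order inside each triple and up to exchange, one of the seven pairs of `2ᵐ`-multiples
  `2ᵐ·((2ᵏ−4,1,3), (2ᵏ⁻¹−2,2ᵏ⁻¹−1,3))` (= d)ₘ), `2ᵐ·((2ᵏ−2,1,1), (2ᵏ⁻¹,1,2ᵏ⁻¹−1))` (= e)ₘ), `2ᵐ·((2ᵏ−2,1,1), (2,2ᵏ⁻¹−1,2ᵏ⁻¹−1))` (= c)ₘ),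
  `2ᵐ·((2ᵏ⁻¹−2,1,2ᵏ⁻¹+1), (2,2ᵏ⁻²−1,3·2ᵏ⁻²−1))` (= a)ₘ), and the three pairs between a)ₘ's triples and e)ₘ₊₁'s triples
  `2ᵐ·(2ᵏ−4,2,2)`, `2ᵐ·(2ᵏ⁻¹,2,2ᵏ⁻¹−2)` ("Furthermore"); `twoPow_theoremFour_arith` (the rewriting `2ᵐ(2ᵏ − 4) = 2ⁿ − 2ᵐ⁺²`, … to K–R's
  `n`); `natCast_exceptional_entries_twoPow` (residues ↔ natural numbers at level `2ᵏ`); and the EQUIVALENCE for every `m`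
  (`fermatCMType_eq_iff_perm_or_exceptional_twoPow_mul`).  The descent `H_{τ′} = H_τ` (level `2ᵐ2ᵏ`) ⟹ `H_{(r′,s′,t′)} = H_{(r,s,t)}`
  (level `2ᵏ`) is the sibling's `fermatCMType_eq_of_fermatCMType_level_mul_eq`; the unit `w₀` of `ℤ/2ᵏ` lifts to `ℤ/2ᵐ2ᵏ`
  (`ZMod.unitsMap_surjective`) compatibly with the transfer map `z ↦ 2ᵐ·⟨z⟩`.

## Honest column / NOT here

* The level is written `2ᵐ·2ᵏ` (not `2ⁿ` with `m ≤ n − 4`) so that the change of level is an identity of types; `twoPow_theoremFour_arith`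
  supplies the rewriting to K–R's `n`.  Entries are natural numbers multiplied by `2ᵐ` (K–R's integer triples); a triple of residues all
  divisible by `2ᵐ` is of this form, not restated.  K–R's ranges `m ≤ n − 3` (a), `n − 2` (c, e), `n − 4` (d) extend below `k = 4`: at
  `k ≤ 3` the members are permutations or unit multiples of each other or live at `N = 8` (sibling `…TwoPowerLevelIsogenies`, kernel
  enumeration); `k ≥ 4` throughout here (the §5 Proposition's `n ≥ 4`).
* SEVEN pairs per `m` where K–R's §5 Proposition prints TEN (sibling `…Classification`'s honest column): the other three are reached through
  a listed pair and a common unit, or are all-even (`2`-content `2ᵐ⁺¹`, i.e. the next `m`).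
* As in every sibling, "isogeny of lattices" = equality of the residue sets `H_τ` read at the full level `N`; the lattices `L_τ ⊂ ℂ^{φ(M)/2}`
  are not constructed, K–R's "apart from the obvious ones" (unit multiple + permutation) is the dichotomy's first branch with the common
  unit `w` of the second, and coincidences between triples of DIFFERENT `2`-content are not treated (for K–R they are excluded by
  `dim L_τ = φ(M)/2`).  Family b) is illegible in our copy (it reads as a)); nothing depends on it.
* The proof of the `m = 0` case is the siblings' (parity criterion, ours — not K–R's omitted argument ∕ Probabilistic Lemma); this file is
  the reduction only.  The one-type form (all pairs of triples in `ℤ/2ⁿ`, the `2`-content found by induction as in the sibling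
  `…PrimePowerAllTriples` §5 for `p = 3`) is not written here.

## References

* [KoblitzRohrlich1978] N. Koblitz, D. Rohrlich, Canad. J. Math. 30 (1978) 1183–1205: Theorem 4 (p. 1186), §1 (pp. 1183–1184), §5
  Proposition (p. 1200).

## Provenance

Cell `pub-hodgecm2` (COR-CM), literature seat `lit-deligne-3` gen 38 (claim KR78-THM4-ALL-M; count-neutral, own lane).
-/

noncomputable section

open NumberField

namespace Literature.AlgebraicGeometry.ComplexMultiplication

open Literature.AlgebraicGeometry.HodgeTheory (fermatCMType)

namespace CyclotomicFermatCMType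

/-! ## THEOREM 4 for every `n = m + k` and every `m` (`k ≥ 4`): coincidences between triples of exact `2`-content `2ᵐ` -/

section TheoremFour

variable {m k : ℕ}

/-- The image of a triple under a map (private copy). [folklore] -/
private theorem map_triple' {α β : Type*} (F : α → β) (x y z : α) :
    (({x, y, z} : Multiset α).map F) = {F x, F y, F z} := by
  simp only [Multiset.insert_eq_cons, Multiset.map_cons, Multiset.map_singleton]

/-- The entries of the seven pairs as natural numbers cast to `ℤ/2ᵏ` (`k ≥ 4`): `−4 = ⟨2ᵏ − 4⟩`, `−2 = ⟨2ᵏ − 2⟩`, `N₁ = ⟨2ᵏ⁻¹⟩`,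
`N₁ ∓ c = ⟨2ᵏ⁻¹ ∓ c⟩`, `N₂ − 1 = ⟨2ᵏ⁻² − 1⟩`, `3N₂ − 1 = ⟨3·2ᵏ⁻² − 1⟩` (and the literals `1, 2, 3`). [cite: KoblitzRohrlich1978, §5 (p. 1200, "`N₁ = 2ⁿ⁻¹`, `N₂ = 2ⁿ⁻²`")] -/
theorem natCast_exceptional_entries_twoPow (hk : 4 ≤ k) :
    (-4 : ZMod (2 ^ k)) = ((2 ^ k - 4 : ℕ) : ZMod (2 ^ k)) ∧ (-2 : ZMod (2 ^ k)) = ((2 ^ k - 2 : ℕ) : ZMod (2 ^ k)) ∧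
      (2 : ZMod (2 ^ k)) ^ (k - 1) = ((2 ^ (k - 1) : ℕ) : ZMod (2 ^ k)) ∧
      (2 : ZMod (2 ^ k)) ^ (k - 1) - 2 = ((2 ^ (k - 1) - 2 : ℕ) : ZMod (2 ^ k)) ∧
      (2 : ZMod (2 ^ k)) ^ (k - 1) - 1 = ((2 ^ (k - 1) - 1 : ℕ) : ZMod (2 ^ k)) ∧
      (2 : ZMod (2 ^ k)) ^ (k - 1) + 1 = ((2 ^ (k - 1) + 1 : ℕ) : ZMod (2 ^ k)) ∧
      (2 : ZMod (2 ^ k)) ^ (k - 2) - 1 = ((2 ^ (k - 2) - 1 : ℕ) : ZMod (2 ^ k)) ∧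
      3 * (2 : ZMod (2 ^ k)) ^ (k - 2) - 1 = ((3 * 2 ^ (k - 2) - 1 : ℕ) : ZMod (2 ^ k)) ∧
      (1 : ZMod (2 ^ k)) = ((1 : ℕ) : ZMod (2 ^ k)) ∧ (2 : ZMod (2 ^ k)) = ((2 : ℕ) : ZMod (2 ^ k)) ∧
      (3 : ZMod (2 ^ k)) = ((3 : ℕ) : ZMod (2 ^ k)) := by
  have h4 : 4 ≤ 2 ^ (k - 2) := by
    calc (4 : ℕ) = 2 ^ 2 := by norm_num
      _ ≤ 2 ^ (k - 2) := Nat.pow_le_pow_right (by norm_num) (by omega)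
  have hk1 : 2 ^ (k - 1) = 2 * 2 ^ (k - 2) := by
    rw [← pow_succ']
    congr 1
    omega
  have hk0 : 2 ^ k = 2 * 2 ^ (k - 1) := by
    rw [← pow_succ']
    congr 1
    omega
  refine ⟨?_, ?_, ?_, ?_, ?_, ?_, ?_, ?_, by norm_num, by norm_num, by norm_num⟩
  · rw [Nat.cast_sub (by omega), ZMod.natCast_self, zero_sub, Nat.cast_ofNat]
  · rw [Nat.cast_sub (by omega), ZMod.natCast_self, zero_sub, Nat.cast_ofNat]
  · push_cast; ring
  · push_cast [Nat.cast_sub (show 2 ≤ 2 ^ (k - 1) by omega)]; ring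
  · push_cast [Nat.cast_sub (show 1 ≤ 2 ^ (k - 1) by omega)]; ring
  · push_cast; ring
  · push_cast [Nat.cast_sub (show 1 ≤ 2 ^ (k - 2) by omega)]; ring
  · push_cast [Nat.cast_sub (show 1 ≤ 3 * 2 ^ (k - 2) by omega)]; ring

/-- **KOBLITZ–ROHRLICH THEOREM 4 — every `n` and every `m` (`n = m + k`, `k ≥ 4`).**  "THEOREM 4. Suppose `N = 2ⁿ`. Then the only
isogenies apart from the obvious ones are between pairs of lattices corresponding to the triples a) `(2ᵐ, 2ⁿ⁻¹ − 2ᵐ⁺¹, 2ⁿ⁻¹ + 2ᵐ)` and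
`(2ᵐ⁺¹, 2ⁿ⁻² − 2ᵐ, 3(2ⁿ⁻²) − 2ᵐ)` for `0 ≤ m ≤ n − 3`, … c) `(2ᵐ, 2ᵐ, 2ⁿ − 2ᵐ⁺¹)` and `(2ᵐ⁺¹, 2ⁿ⁻¹ − 2ᵐ, 2ⁿ⁻¹ − 2ᵐ)` for
`0 ≤ m ≤ n − 2`, or d) `(2ᵐ, 3(2ᵐ), 2ⁿ − 2ᵐ⁺²)` and `(2ⁿ⁻¹ − 2ᵐ, 2ⁿ⁻¹ − 2ᵐ⁺¹, 3(2ᵐ))` for `0 ≤ m ≤ n − 4`, or e) `(2ᵐ, 2ⁿ⁻¹, 2ⁿ⁻¹ − 2ᵐ)`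
and `(2ᵐ, 2ᵐ, 2ⁿ − 2ᵐ⁺¹)` for `0 ≤ m ≤ n − 2`.  Furthermore, a lattice of type a)ₘ is isogenous to the product of two lattices of type
e)ₘ₊₁."  Tree form, at level `N = 2ᵐ·2ᵏ` (`n = m + k`, `k ≥ 4`): let `τ = (2ᵐr, 2ᵐs, 2ᵐt)`, `τ′ = (2ᵐr′, 2ᵐs′, 2ᵐt′)` for natural numbers
`r, …, t′` non-zero modulo `2ᵏ`, with `r + s + t ≡ 0 ≡ r′ + s′ + t′ (mod 2ᵏ)` and one of the six odd (exact common `2`-content `2ᵐ`,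
g.c.d.`(N, τ, τ′) = 2ᵐ`).  If `H_{τ′} = H_τ` modulo `N`, then EITHER `{τ′} = {τ}` OR for a unit `w` modulo `N` the pair `(wτ, wτ′)` is, up to
order inside each triple and up to exchanging the two, one of the SEVEN pairs `2ᵐ·((2ᵏ−4, 1, 3), (2ᵏ⁻¹−2, 2ᵏ⁻¹−1, 3))` = d)ₘ,
`2ᵐ·((2ᵏ−2, 1, 1), (2ᵏ⁻¹, 1, 2ᵏ⁻¹−1))` = e)ₘ, `2ᵐ·((2ᵏ−2, 1, 1), (2, 2ᵏ⁻¹−1, 2ᵏ⁻¹−1))` = c)ₘ, `2ᵐ·((2ᵏ⁻¹−2, 1, 2ᵏ⁻¹+1), (2ᵏ−4, 2, 2))`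
(a)ₘ's first triple with e)ₘ₊₁'s second, "Furthermore"), `2ᵐ·((2ᵏ⁻¹−2, 1, 2ᵏ⁻¹+1), (2, 2ᵏ⁻²−1, 3·2ᵏ⁻²−1))` = a)ₘ,
`2ᵐ·((2ᵏ⁻¹−2, 1, 2ᵏ⁻¹+1), (2ᵏ⁻¹, 2, 2ᵏ⁻¹−2))` (a)ₘ's first with e)ₘ₊₁'s first), `2ᵐ·((2, 2ᵏ⁻²−1, 3·2ᵏ⁻²−1), (2ᵏ−4, 2, 2))` (a)ₘ's
second with e)ₘ₊₁'s second) — the arithmetic `2ᵐ(2ᵏ − 4) = 2ⁿ − 2ᵐ⁺²`, … is `twoPow_theoremFour_arith`.  Reduction to `m = 0` (the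
sibling's `perm_or_exceptional_of_fermatCMType_eq_twoPow` at level `2ᵏ`, the §5 Proposition) by the change of level of §1.
[cite: KoblitzRohrlich1978, Theorem 4 (p. 1186), §5 Proposition (p. 1200), §1 (pp. 1183–1184)] -/
theorem perm_or_exceptional_of_fermatCMType_eq_twoPow_mul [NeZero (2 ^ k)] [NeZero (2 ^ m * 2 ^ k)] (hk : 4 ≤ k)
    {r s t r' s' t' : ℕ}
    (hr : (r : ZMod (2 ^ k)) ≠ 0) (hs : (s : ZMod (2 ^ k)) ≠ 0) (ht : (t : ZMod (2 ^ k)) ≠ 0)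
    (hrst : ((r + s + t : ℕ) : ZMod (2 ^ k)) = 0)
    (hr' : (r' : ZMod (2 ^ k)) ≠ 0) (hs' : (s' : ZMod (2 ^ k)) ≠ 0) (ht' : (t' : ZMod (2 ^ k)) ≠ 0)
    (hrst' : ((r' + s' + t' : ℕ) : ZMod (2 ^ k)) = 0)
    (hunit : IsUnit (r : ZMod (2 ^ k)) ∨ IsUnit (s : ZMod (2 ^ k)) ∨ IsUnit (t : ZMod (2 ^ k)) ∨
      IsUnit (r' : ZMod (2 ^ k)) ∨ IsUnit (s' : ZMod (2 ^ k)) ∨ IsUnit (t' : ZMod (2 ^ k)))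
    (heq : fermatCMType (2 ^ m * 2 ^ k) ((2 ^ m * r' : ℕ) : ZMod (2 ^ m * 2 ^ k)) ((2 ^ m * s' : ℕ) : ZMod (2 ^ m * 2 ^ k))
        ((2 ^ m * t' : ℕ) : ZMod (2 ^ m * 2 ^ k)) =
      fermatCMType (2 ^ m * 2 ^ k) ((2 ^ m * r : ℕ) : ZMod (2 ^ m * 2 ^ k)) ((2 ^ m * s : ℕ) : ZMod (2 ^ m * 2 ^ k))
        ((2 ^ m * t : ℕ) : ZMod (2 ^ m * 2 ^ k))) :
    ({((2 ^ m * r' : ℕ) : ZMod (2 ^ m * 2 ^ k)), ((2 ^ m * s' : ℕ) : ZMod (2 ^ m * 2 ^ k)), ((2 ^ m * t' : ℕ) : ZMod (2 ^ m * 2 ^ k))} :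
        Multiset (ZMod (2 ^ m * 2 ^ k))) =
      {((2 ^ m * r : ℕ) : ZMod (2 ^ m * 2 ^ k)), ((2 ^ m * s : ℕ) : ZMod (2 ^ m * 2 ^ k)), ((2 ^ m * t : ℕ) : ZMod (2 ^ m * 2 ^ k))} ∨
    ∃ w : ZMod (2 ^ m * 2 ^ k), IsUnit w ∧
      (((({w * ((2 ^ m * r : ℕ) : ZMod (2 ^ m * 2 ^ k)), w * ((2 ^ m * s : ℕ) : ZMod (2 ^ m * 2 ^ k)),
          w * ((2 ^ m * t : ℕ) : ZMod (2 ^ m * 2 ^ k))} : Multiset (ZMod (2 ^ m * 2 ^ k))) =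
          {((2 ^ m * (2 ^ k - 4) : ℕ) : ZMod (2 ^ m * 2 ^ k)), ((2 ^ m * 1 : ℕ) : ZMod (2 ^ m * 2 ^ k)),
            ((2 ^ m * 3 : ℕ) : ZMod (2 ^ m * 2 ^ k))} ∧
        ({w * ((2 ^ m * r' : ℕ) : ZMod (2 ^ m * 2 ^ k)), w * ((2 ^ m * s' : ℕ) : ZMod (2 ^ m * 2 ^ k)),
          w * ((2 ^ m * t' : ℕ) : ZMod (2 ^ m * 2 ^ k))} : Multiset (ZMod (2 ^ m * 2 ^ k))) =
          {((2 ^ m * (2 ^ (k - 1) - 2) : ℕ) : ZMod (2 ^ m * 2 ^ k)), ((2 ^ m * (2 ^ (k - 1) - 1) : ℕ) : ZMod (2 ^ m * 2 ^ k)),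
            ((2 ^ m * 3 : ℕ) : ZMod (2 ^ m * 2 ^ k))}) ∨
        (({w * ((2 ^ m * r : ℕ) : ZMod (2 ^ m * 2 ^ k)), w * ((2 ^ m * s : ℕ) : ZMod (2 ^ m * 2 ^ k)),
          w * ((2 ^ m * t : ℕ) : ZMod (2 ^ m * 2 ^ k))} : Multiset (ZMod (2 ^ m * 2 ^ k))) =
          {((2 ^ m * (2 ^ (k - 1) - 2) : ℕ) : ZMod (2 ^ m * 2 ^ k)), ((2 ^ m * (2 ^ (k - 1) - 1) : ℕ) : ZMod (2 ^ m * 2 ^ k)),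
            ((2 ^ m * 3 : ℕ) : ZMod (2 ^ m * 2 ^ k))} ∧
        ({w * ((2 ^ m * r' : ℕ) : ZMod (2 ^ m * 2 ^ k)), w * ((2 ^ m * s' : ℕ) : ZMod (2 ^ m * 2 ^ k)),
          w * ((2 ^ m * t' : ℕ) : ZMod (2 ^ m * 2 ^ k))} : Multiset (ZMod (2 ^ m * 2 ^ k))) =
          {((2 ^ m * (2 ^ k - 4) : ℕ) : ZMod (2 ^ m * 2 ^ k)), ((2 ^ m * 1 : ℕ) : ZMod (2 ^ m * 2 ^ k)),
            ((2 ^ m * 3 : ℕ) : ZMod (2 ^ m * 2 ^ k))})) ∨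
      ((({w * ((2 ^ m * r : ℕ) : ZMod (2 ^ m * 2 ^ k)), w * ((2 ^ m * s : ℕ) : ZMod (2 ^ m * 2 ^ k)),
          w * ((2 ^ m * t : ℕ) : ZMod (2 ^ m * 2 ^ k))} : Multiset (ZMod (2 ^ m * 2 ^ k))) =
          {((2 ^ m * (2 ^ k - 2) : ℕ) : ZMod (2 ^ m * 2 ^ k)), ((2 ^ m * 1 : ℕ) : ZMod (2 ^ m * 2 ^ k)),
            ((2 ^ m * 1 : ℕ) : ZMod (2 ^ m * 2 ^ k))} ∧
        ({w * ((2 ^ m * r' : ℕ) : ZMod (2 ^ m * 2 ^ k)), w * ((2 ^ m * s' : ℕ) : ZMod (2 ^ m * 2 ^ k)),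
          w * ((2 ^ m * t' : ℕ) : ZMod (2 ^ m * 2 ^ k))} : Multiset (ZMod (2 ^ m * 2 ^ k))) =
          {((2 ^ m * 2 ^ (k - 1) : ℕ) : ZMod (2 ^ m * 2 ^ k)), ((2 ^ m * 1 : ℕ) : ZMod (2 ^ m * 2 ^ k)),
            ((2 ^ m * (2 ^ (k - 1) - 1) : ℕ) : ZMod (2 ^ m * 2 ^ k))}) ∨
        (({w * ((2 ^ m * r : ℕ) : ZMod (2 ^ m * 2 ^ k)), w * ((2 ^ m * s : ℕ) : ZMod (2 ^ m * 2 ^ k)),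
          w * ((2 ^ m * t : ℕ) : ZMod (2 ^ m * 2 ^ k))} : Multiset (ZMod (2 ^ m * 2 ^ k))) =
          {((2 ^ m * 2 ^ (k - 1) : ℕ) : ZMod (2 ^ m * 2 ^ k)), ((2 ^ m * 1 : ℕ) : ZMod (2 ^ m * 2 ^ k)),
            ((2 ^ m * (2 ^ (k - 1) - 1) : ℕ) : ZMod (2 ^ m * 2 ^ k))} ∧
        ({w * ((2 ^ m * r' : ℕ) : ZMod (2 ^ m * 2 ^ k)), w * ((2 ^ m * s' : ℕ) : ZMod (2 ^ m * 2 ^ k)),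
          w * ((2 ^ m * t' : ℕ) : ZMod (2 ^ m * 2 ^ k))} : Multiset (ZMod (2 ^ m * 2 ^ k))) =
          {((2 ^ m * (2 ^ k - 2) : ℕ) : ZMod (2 ^ m * 2 ^ k)), ((2 ^ m * 1 : ℕ) : ZMod (2 ^ m * 2 ^ k)),
            ((2 ^ m * 1 : ℕ) : ZMod (2 ^ m * 2 ^ k))})) ∨
      ((({w * ((2 ^ m * r : ℕ) : ZMod (2 ^ m * 2 ^ k)), w * ((2 ^ m * s : ℕ) : ZMod (2 ^ m * 2 ^ k)),
          w * ((2 ^ m * t : ℕ) : ZMod (2 ^ m * 2 ^ k))} : Multiset (ZMod (2 ^ m * 2 ^ k))) =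
          {((2 ^ m * (2 ^ k - 2) : ℕ) : ZMod (2 ^ m * 2 ^ k)), ((2 ^ m * 1 : ℕ) : ZMod (2 ^ m * 2 ^ k)),
            ((2 ^ m * 1 : ℕ) : ZMod (2 ^ m * 2 ^ k))} ∧
        ({w * ((2 ^ m * r' : ℕ) : ZMod (2 ^ m * 2 ^ k)), w * ((2 ^ m * s' : ℕ) : ZMod (2 ^ m * 2 ^ k)),
          w * ((2 ^ m * t' : ℕ) : ZMod (2 ^ m * 2 ^ k))} : Multiset (ZMod (2 ^ m * 2 ^ k))) =
          {((2 ^ m * 2 : ℕ) : ZMod (2 ^ m * 2 ^ k)), ((2 ^ m * (2 ^ (k - 1) - 1) : ℕ) : ZMod (2 ^ m * 2 ^ k)),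
            ((2 ^ m * (2 ^ (k - 1) - 1) : ℕ) : ZMod (2 ^ m * 2 ^ k))}) ∨
        (({w * ((2 ^ m * r : ℕ) : ZMod (2 ^ m * 2 ^ k)), w * ((2 ^ m * s : ℕ) : ZMod (2 ^ m * 2 ^ k)),
          w * ((2 ^ m * t : ℕ) : ZMod (2 ^ m * 2 ^ k))} : Multiset (ZMod (2 ^ m * 2 ^ k))) =
          {((2 ^ m * 2 : ℕ) : ZMod (2 ^ m * 2 ^ k)), ((2 ^ m * (2 ^ (k - 1) - 1) : ℕ) : ZMod (2 ^ m * 2 ^ k)),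
            ((2 ^ m * (2 ^ (k - 1) - 1) : ℕ) : ZMod (2 ^ m * 2 ^ k))} ∧
        ({w * ((2 ^ m * r' : ℕ) : ZMod (2 ^ m * 2 ^ k)), w * ((2 ^ m * s' : ℕ) : ZMod (2 ^ m * 2 ^ k)),
          w * ((2 ^ m * t' : ℕ) : ZMod (2 ^ m * 2 ^ k))} : Multiset (ZMod (2 ^ m * 2 ^ k))) =
          {((2 ^ m * (2 ^ k - 2) : ℕ) : ZMod (2 ^ m * 2 ^ k)), ((2 ^ m * 1 : ℕ) : ZMod (2 ^ m * 2 ^ k)),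
            ((2 ^ m * 1 : ℕ) : ZMod (2 ^ m * 2 ^ k))})) ∨
      ((({w * ((2 ^ m * r : ℕ) : ZMod (2 ^ m * 2 ^ k)), w * ((2 ^ m * s : ℕ) : ZMod (2 ^ m * 2 ^ k)),
          w * ((2 ^ m * t : ℕ) : ZMod (2 ^ m * 2 ^ k))} : Multiset (ZMod (2 ^ m * 2 ^ k))) =
          {((2 ^ m * (2 ^ (k - 1) - 2) : ℕ) : ZMod (2 ^ m * 2 ^ k)), ((2 ^ m * 1 : ℕ) : ZMod (2 ^ m * 2 ^ k)),
            ((2 ^ m * (2 ^ (k - 1) + 1) : ℕ) : ZMod (2 ^ m * 2 ^ k))} ∧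
        ({w * ((2 ^ m * r' : ℕ) : ZMod (2 ^ m * 2 ^ k)), w * ((2 ^ m * s' : ℕ) : ZMod (2 ^ m * 2 ^ k)),
          w * ((2 ^ m * t' : ℕ) : ZMod (2 ^ m * 2 ^ k))} : Multiset (ZMod (2 ^ m * 2 ^ k))) =
          {((2 ^ m * (2 ^ k - 4) : ℕ) : ZMod (2 ^ m * 2 ^ k)), ((2 ^ m * 2 : ℕ) : ZMod (2 ^ m * 2 ^ k)),
            ((2 ^ m * 2 : ℕ) : ZMod (2 ^ m * 2 ^ k))}) ∨
        (({w * ((2 ^ m * r : ℕ) : ZMod (2 ^ m * 2 ^ k)), w * ((2 ^ m * s : ℕ) : ZMod (2 ^ m * 2 ^ k)),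
          w * ((2 ^ m * t : ℕ) : ZMod (2 ^ m * 2 ^ k))} : Multiset (ZMod (2 ^ m * 2 ^ k))) =
          {((2 ^ m * (2 ^ k - 4) : ℕ) : ZMod (2 ^ m * 2 ^ k)), ((2 ^ m * 2 : ℕ) : ZMod (2 ^ m * 2 ^ k)),
            ((2 ^ m * 2 : ℕ) : ZMod (2 ^ m * 2 ^ k))} ∧
        ({w * ((2 ^ m * r' : ℕ) : ZMod (2 ^ m * 2 ^ k)), w * ((2 ^ m * s' : ℕ) : ZMod (2 ^ m * 2 ^ k)),
          w * ((2 ^ m * t' : ℕ) : ZMod (2 ^ m * 2 ^ k))} : Multiset (ZMod (2 ^ m * 2 ^ k))) =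
          {((2 ^ m * (2 ^ (k - 1) - 2) : ℕ) : ZMod (2 ^ m * 2 ^ k)), ((2 ^ m * 1 : ℕ) : ZMod (2 ^ m * 2 ^ k)),
            ((2 ^ m * (2 ^ (k - 1) + 1) : ℕ) : ZMod (2 ^ m * 2 ^ k))})) ∨
      ((({w * ((2 ^ m * r : ℕ) : ZMod (2 ^ m * 2 ^ k)), w * ((2 ^ m * s : ℕ) : ZMod (2 ^ m * 2 ^ k)),
          w * ((2 ^ m * t : ℕ) : ZMod (2 ^ m * 2 ^ k))} : Multiset (ZMod (2 ^ m * 2 ^ k))) =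
          {((2 ^ m * (2 ^ (k - 1) - 2) : ℕ) : ZMod (2 ^ m * 2 ^ k)), ((2 ^ m * 1 : ℕ) : ZMod (2 ^ m * 2 ^ k)),
            ((2 ^ m * (2 ^ (k - 1) + 1) : ℕ) : ZMod (2 ^ m * 2 ^ k))} ∧
        ({w * ((2 ^ m * r' : ℕ) : ZMod (2 ^ m * 2 ^ k)), w * ((2 ^ m * s' : ℕ) : ZMod (2 ^ m * 2 ^ k)),
          w * ((2 ^ m * t' : ℕ) : ZMod (2 ^ m * 2 ^ k))} : Multiset (ZMod (2 ^ m * 2 ^ k))) =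
          {((2 ^ m * 2 : ℕ) : ZMod (2 ^ m * 2 ^ k)), ((2 ^ m * (2 ^ (k - 2) - 1) : ℕ) : ZMod (2 ^ m * 2 ^ k)),
            ((2 ^ m * (3 * 2 ^ (k - 2) - 1) : ℕ) : ZMod (2 ^ m * 2 ^ k))}) ∨
        (({w * ((2 ^ m * r : ℕ) : ZMod (2 ^ m * 2 ^ k)), w * ((2 ^ m * s : ℕ) : ZMod (2 ^ m * 2 ^ k)),
          w * ((2 ^ m * t : ℕ) : ZMod (2 ^ m * 2 ^ k))} : Multiset (ZMod (2 ^ m * 2 ^ k))) =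
          {((2 ^ m * 2 : ℕ) : ZMod (2 ^ m * 2 ^ k)), ((2 ^ m * (2 ^ (k - 2) - 1) : ℕ) : ZMod (2 ^ m * 2 ^ k)),
            ((2 ^ m * (3 * 2 ^ (k - 2) - 1) : ℕ) : ZMod (2 ^ m * 2 ^ k))} ∧
        ({w * ((2 ^ m * r' : ℕ) : ZMod (2 ^ m * 2 ^ k)), w * ((2 ^ m * s' : ℕ) : ZMod (2 ^ m * 2 ^ k)),
          w * ((2 ^ m * t' : ℕ) : ZMod (2 ^ m * 2 ^ k))} : Multiset (ZMod (2 ^ m * 2 ^ k))) =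
          {((2 ^ m * (2 ^ (k - 1) - 2) : ℕ) : ZMod (2 ^ m * 2 ^ k)), ((2 ^ m * 1 : ℕ) : ZMod (2 ^ m * 2 ^ k)),
            ((2 ^ m * (2 ^ (k - 1) + 1) : ℕ) : ZMod (2 ^ m * 2 ^ k))})) ∨
      ((({w * ((2 ^ m * r : ℕ) : ZMod (2 ^ m * 2 ^ k)), w * ((2 ^ m * s : ℕ) : ZMod (2 ^ m * 2 ^ k)),
          w * ((2 ^ m * t : ℕ) : ZMod (2 ^ m * 2 ^ k))} : Multiset (ZMod (2 ^ m * 2 ^ k))) =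
          {((2 ^ m * (2 ^ (k - 1) - 2) : ℕ) : ZMod (2 ^ m * 2 ^ k)), ((2 ^ m * 1 : ℕ) : ZMod (2 ^ m * 2 ^ k)),
            ((2 ^ m * (2 ^ (k - 1) + 1) : ℕ) : ZMod (2 ^ m * 2 ^ k))} ∧
        ({w * ((2 ^ m * r' : ℕ) : ZMod (2 ^ m * 2 ^ k)), w * ((2 ^ m * s' : ℕ) : ZMod (2 ^ m * 2 ^ k)),
          w * ((2 ^ m * t' : ℕ) : ZMod (2 ^ m * 2 ^ k))} : Multiset (ZMod (2 ^ m * 2 ^ k))) =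
          {((2 ^ m * 2 ^ (k - 1) : ℕ) : ZMod (2 ^ m * 2 ^ k)), ((2 ^ m * 2 : ℕ) : ZMod (2 ^ m * 2 ^ k)),
            ((2 ^ m * (2 ^ (k - 1) - 2) : ℕ) : ZMod (2 ^ m * 2 ^ k))}) ∨
        (({w * ((2 ^ m * r : ℕ) : ZMod (2 ^ m * 2 ^ k)), w * ((2 ^ m * s : ℕ) : ZMod (2 ^ m * 2 ^ k)),
          w * ((2 ^ m * t : ℕ) : ZMod (2 ^ m * 2 ^ k))} : Multiset (ZMod (2 ^ m * 2 ^ k))) =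
          {((2 ^ m * 2 ^ (k - 1) : ℕ) : ZMod (2 ^ m * 2 ^ k)), ((2 ^ m * 2 : ℕ) : ZMod (2 ^ m * 2 ^ k)),
            ((2 ^ m * (2 ^ (k - 1) - 2) : ℕ) : ZMod (2 ^ m * 2 ^ k))} ∧
        ({w * ((2 ^ m * r' : ℕ) : ZMod (2 ^ m * 2 ^ k)), w * ((2 ^ m * s' : ℕ) : ZMod (2 ^ m * 2 ^ k)),
          w * ((2 ^ m * t' : ℕ) : ZMod (2 ^ m * 2 ^ k))} : Multiset (ZMod (2 ^ m * 2 ^ k))) =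
          {((2 ^ m * (2 ^ (k - 1) - 2) : ℕ) : ZMod (2 ^ m * 2 ^ k)), ((2 ^ m * 1 : ℕ) : ZMod (2 ^ m * 2 ^ k)),
            ((2 ^ m * (2 ^ (k - 1) + 1) : ℕ) : ZMod (2 ^ m * 2 ^ k))})) ∨
      ((({w * ((2 ^ m * r : ℕ) : ZMod (2 ^ m * 2 ^ k)), w * ((2 ^ m * s : ℕ) : ZMod (2 ^ m * 2 ^ k)),
          w * ((2 ^ m * t : ℕ) : ZMod (2 ^ m * 2 ^ k))} : Multiset (ZMod (2 ^ m * 2 ^ k))) =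
          {((2 ^ m * 2 : ℕ) : ZMod (2 ^ m * 2 ^ k)), ((2 ^ m * (2 ^ (k - 2) - 1) : ℕ) : ZMod (2 ^ m * 2 ^ k)),
            ((2 ^ m * (3 * 2 ^ (k - 2) - 1) : ℕ) : ZMod (2 ^ m * 2 ^ k))} ∧
        ({w * ((2 ^ m * r' : ℕ) : ZMod (2 ^ m * 2 ^ k)), w * ((2 ^ m * s' : ℕ) : ZMod (2 ^ m * 2 ^ k)),
          w * ((2 ^ m * t' : ℕ) : ZMod (2 ^ m * 2 ^ k))} : Multiset (ZMod (2 ^ m * 2 ^ k))) =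
          {((2 ^ m * (2 ^ k - 4) : ℕ) : ZMod (2 ^ m * 2 ^ k)), ((2 ^ m * 2 : ℕ) : ZMod (2 ^ m * 2 ^ k)),
            ((2 ^ m * 2 : ℕ) : ZMod (2 ^ m * 2 ^ k))}) ∨
        (({w * ((2 ^ m * r : ℕ) : ZMod (2 ^ m * 2 ^ k)), w * ((2 ^ m * s : ℕ) : ZMod (2 ^ m * 2 ^ k)),
          w * ((2 ^ m * t : ℕ) : ZMod (2 ^ m * 2 ^ k))} : Multiset (ZMod (2 ^ m * 2 ^ k))) =
          {((2 ^ m * (2 ^ k - 4) : ℕ) : ZMod (2 ^ m * 2 ^ k)), ((2 ^ m * 2 : ℕ) : ZMod (2 ^ m * 2 ^ k)),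
            ((2 ^ m * 2 : ℕ) : ZMod (2 ^ m * 2 ^ k))} ∧
        ({w * ((2 ^ m * r' : ℕ) : ZMod (2 ^ m * 2 ^ k)), w * ((2 ^ m * s' : ℕ) : ZMod (2 ^ m * 2 ^ k)),
          w * ((2 ^ m * t' : ℕ) : ZMod (2 ^ m * 2 ^ k))} : Multiset (ZMod (2 ^ m * 2 ^ k))) =
          {((2 ^ m * 2 : ℕ) : ZMod (2 ^ m * 2 ^ k)), ((2 ^ m * (2 ^ (k - 2) - 1) : ℕ) : ZMod (2 ^ m * 2 ^ k)),
            ((2 ^ m * (3 * 2 ^ (k - 2) - 1) : ℕ) : ZMod (2 ^ m * 2 ^ k))}))) := by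
  classical
  have hk0 : k ≠ 0 := by omega
  -- the level-`2ᵏ` coincidence and the §5 Proposition there
  have heqk := fermatCMType_eq_of_fermatCMType_level_mul_eq (pow_pos (by norm_num : 0 < 2) m) heq
  have hsum : (r : ZMod (2 ^ k)) + s + t = 0 := by exact_mod_cast hrst
  have hsum' : (r' : ZMod (2 ^ k)) + s' + t' = 0 := by exact_mod_cast hrst'
  -- the transfer map `z ↦ 2ᵐ·⟨z⟩`
  set F : ZMod (2 ^ k) → ZMod (2 ^ m * 2 ^ k) :=
    fun z => ((2 ^ m : ℕ) : ZMod (2 ^ m * 2 ^ k)) * (z.val : ZMod (2 ^ m * 2 ^ k)) with hF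
  have hFnat : ∀ a : ℕ, F (a : ZMod (2 ^ k)) = ((2 ^ m * a : ℕ) : ZMod (2 ^ m * 2 ^ k)) := fun a =>
    (natCast_mul_eq_mul_val a).symm
  rcases perm_or_exceptional_of_fermatCMType_eq_twoPow hk hr hs ht hsum hr' hs' ht' hsum' hunit heqk with hperm | ⟨w₀, hw₀, hK⟩
  · left
    have h := congrArg (Multiset.map F) hperm
    rw [map_triple', map_triple', hFnat, hFnat, hFnat, hFnat, hFnat, hFnat] at h
    exact h
  · right
    -- lift the unit `w₀` of `ℤ/2ᵏ` to a unit `w` of `ℤ/2ᵐ2ᵏ`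
    obtain ⟨W, hW⟩ := ZMod.unitsMap_surjective (dvd_mul_left (2 ^ k) (2 ^ m)) hw₀.unit
    have hWw : ZMod.castHom (dvd_mul_left (2 ^ k) (2 ^ m)) (ZMod (2 ^ k)) (W : ZMod (2 ^ m * 2 ^ k)) = w₀ := by
      have h1 := congrArg (fun u : (ZMod (2 ^ k))ˣ => (u : ZMod (2 ^ k))) hW
      simp only [ZMod.unitsMap_val, IsUnit.unit_spec] at h1
      rw [ZMod.castHom_apply]
      exact h1
    -- `w·2ᵐa = F(w₀·ā)`
    have hmul : ∀ a : ℕ, (W : ZMod (2 ^ m * 2 ^ k)) * ((2 ^ m * a : ℕ) : ZMod (2 ^ m * 2 ^ k)) = F (w₀ * (a : ZMod (2 ^ k))) := by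
      intro a
      rw [hF]
      simp only
      rw [← hWw, ← map_natCast (ZMod.castHom (dvd_mul_left (2 ^ k) (2 ^ m)) (ZMod (2 ^ k))) a, ← map_mul,
        mul_natCast_val_castHom, Nat.cast_mul]
      ring
    -- the entries of the seven pairs as natural numbers modulo `2ᵏ`
    obtain ⟨eM4, eM2, eP1, eP1m2, eP1m1, eP1p1, eP2m1, eP2x3m1, eOne, eTwo, eThree⟩ := natCast_exceptional_entries_twoPow hk

    have mapAD : (({-4, 1, 3} : Multiset (ZMod (2 ^ k))).map F) =
        {((2 ^ m * (2 ^ k - 4) : ℕ) : ZMod (2 ^ m * 2 ^ k)), ((2 ^ m * 1 : ℕ) : ZMod (2 ^ m * 2 ^ k)),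
          ((2 ^ m * 3 : ℕ) : ZMod (2 ^ m * 2 ^ k))} := by
      rw [map_triple', eM4, eThree, eOne]
      simp only [hFnat]
    have mapBD : (({(2 : ZMod (2 ^ k)) ^ (k - 1) - 2, (2 : ZMod (2 ^ k)) ^ (k - 1) - 1, 3} : Multiset (ZMod (2 ^ k))).map F) =
        {((2 ^ m * (2 ^ (k - 1) - 2) : ℕ) : ZMod (2 ^ m * 2 ^ k)), ((2 ^ m * (2 ^ (k - 1) - 1) : ℕ) : ZMod (2 ^ m * 2 ^ k)),
          ((2 ^ m * 3 : ℕ) : ZMod (2 ^ m * 2 ^ k))} := by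
      rw [map_triple', eP1m2, eP1m1, eThree]
      simp only [hFnat]
    have mapAE : (({-2, 1, 1} : Multiset (ZMod (2 ^ k))).map F) =
        {((2 ^ m * (2 ^ k - 2) : ℕ) : ZMod (2 ^ m * 2 ^ k)), ((2 ^ m * 1 : ℕ) : ZMod (2 ^ m * 2 ^ k)),
          ((2 ^ m * 1 : ℕ) : ZMod (2 ^ m * 2 ^ k))} := by
      rw [map_triple', eM2, eOne]
      simp only [hFnat]
    have mapBE1 : (({(2 : ZMod (2 ^ k)) ^ (k - 1), 1, (2 : ZMod (2 ^ k)) ^ (k - 1) - 1} : Multiset (ZMod (2 ^ k))).map F) =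
        {((2 ^ m * 2 ^ (k - 1) : ℕ) : ZMod (2 ^ m * 2 ^ k)), ((2 ^ m * 1 : ℕ) : ZMod (2 ^ m * 2 ^ k)),
          ((2 ^ m * (2 ^ (k - 1) - 1) : ℕ) : ZMod (2 ^ m * 2 ^ k))} := by
      rw [map_triple', eP1m1, eP1, eOne]
      simp only [hFnat]
    have mapBE2 : (({2, (2 : ZMod (2 ^ k)) ^ (k - 1) - 1, (2 : ZMod (2 ^ k)) ^ (k - 1) - 1} : Multiset (ZMod (2 ^ k))).map F) =
        {((2 ^ m * 2 : ℕ) : ZMod (2 ^ m * 2 ^ k)), ((2 ^ m * (2 ^ (k - 1) - 1) : ℕ) : ZMod (2 ^ m * 2 ^ k)),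
          ((2 ^ m * (2 ^ (k - 1) - 1) : ℕ) : ZMod (2 ^ m * 2 ^ k))} := by
      rw [map_triple', eP1m1, eTwo]
      simp only [hFnat]
    have mapAA : (({(2 : ZMod (2 ^ k)) ^ (k - 1) - 2, 1, (2 : ZMod (2 ^ k)) ^ (k - 1) + 1} : Multiset (ZMod (2 ^ k))).map F) =
        {((2 ^ m * (2 ^ (k - 1) - 2) : ℕ) : ZMod (2 ^ m * 2 ^ k)), ((2 ^ m * 1 : ℕ) : ZMod (2 ^ m * 2 ^ k)),
          ((2 ^ m * (2 ^ (k - 1) + 1) : ℕ) : ZMod (2 ^ m * 2 ^ k))} := by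
      rw [map_triple', eP1m2, eP1p1, eOne]
      simp only [hFnat]
    have mapBA1 : (({-4, 2, 2} : Multiset (ZMod (2 ^ k))).map F) =
        {((2 ^ m * (2 ^ k - 4) : ℕ) : ZMod (2 ^ m * 2 ^ k)), ((2 ^ m * 2 : ℕ) : ZMod (2 ^ m * 2 ^ k)),
          ((2 ^ m * 2 : ℕ) : ZMod (2 ^ m * 2 ^ k))} := by
      rw [map_triple', eM4, eTwo]
      simp only [hFnat]
    have mapBA2 : (({(2 : ZMod (2 ^ k)) ^ (k - 1), 2, (2 : ZMod (2 ^ k)) ^ (k - 1) - 2} : Multiset (ZMod (2 ^ k))).map F) =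
        {((2 ^ m * 2 ^ (k - 1) : ℕ) : ZMod (2 ^ m * 2 ^ k)), ((2 ^ m * 2 : ℕ) : ZMod (2 ^ m * 2 ^ k)),
          ((2 ^ m * (2 ^ (k - 1) - 2) : ℕ) : ZMod (2 ^ m * 2 ^ k))} := by
      rw [map_triple', eP1m2, eP1, eTwo]
      simp only [hFnat]
    have mapBA3 : (({2, (2 : ZMod (2 ^ k)) ^ (k - 2) - 1, 3 * (2 : ZMod (2 ^ k)) ^ (k - 2) - 1} : Multiset (ZMod (2 ^ k))).map F) =
        {((2 ^ m * 2 : ℕ) : ZMod (2 ^ m * 2 ^ k)), ((2 ^ m * (2 ^ (k - 2) - 1) : ℕ) : ZMod (2 ^ m * 2 ^ k)),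
          ((2 ^ m * (3 * 2 ^ (k - 2) - 1) : ℕ) : ZMod (2 ^ m * 2 ^ k))} := by
      rw [map_triple', eP2x3m1, eP2m1, eTwo]
      simp only [hFnat]
    have mapτ : (({w₀ * (r : ZMod (2 ^ k)), w₀ * (s : ZMod (2 ^ k)), w₀ * (t : ZMod (2 ^ k))} : Multiset (ZMod (2 ^ k))).map F) =
        ({(W : ZMod (2 ^ m * 2 ^ k)) * ((2 ^ m * r : ℕ) : ZMod (2 ^ m * 2 ^ k)), (W : ZMod (2 ^ m * 2 ^ k)) * ((2 ^ m * s : ℕ) : ZMod (2 ^ m * 2 ^ k)),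
          (W : ZMod (2 ^ m * 2 ^ k)) * ((2 ^ m * t : ℕ) : ZMod (2 ^ m * 2 ^ k))} : Multiset (ZMod (2 ^ m * 2 ^ k))) := by
      rw [map_triple', hmul, hmul, hmul]
    have mapτ' : (({w₀ * (r' : ZMod (2 ^ k)), w₀ * (s' : ZMod (2 ^ k)), w₀ * (t' : ZMod (2 ^ k))} : Multiset (ZMod (2 ^ k))).map F) =
        ({(W : ZMod (2 ^ m * 2 ^ k)) * ((2 ^ m * r' : ℕ) : ZMod (2 ^ m * 2 ^ k)), (W : ZMod (2 ^ m * 2 ^ k)) * ((2 ^ m * s' : ℕ) : ZMod (2 ^ m * 2 ^ k)),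
          (W : ZMod (2 ^ m * 2 ^ k)) * ((2 ^ m * t' : ℕ) : ZMod (2 ^ m * 2 ^ k))} : Multiset (ZMod (2 ^ m * 2 ^ k))) := by
      rw [map_triple', hmul, hmul, hmul]
    refine ⟨(W : ZMod (2 ^ m * 2 ^ k)), Units.isUnit W, ?_⟩
    rcases hK with (⟨hA, hB⟩ | ⟨hA, hB⟩) | (⟨hA, hB⟩ | ⟨hA, hB⟩) | (⟨hA, hB⟩ | ⟨hA, hB⟩) | (⟨hA, hB⟩ | ⟨hA, hB⟩) |
      (⟨hA, hB⟩ | ⟨hA, hB⟩) | (⟨hA, hB⟩ | ⟨hA, hB⟩) | (⟨hA, hB⟩ | ⟨hA, hB⟩)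
    · exact Or.inl (Or.inl ⟨by rw [← mapτ, hA, mapAD], by rw [← mapτ', hB, mapBD]⟩)
    · exact Or.inl (Or.inr ⟨by rw [← mapτ, hA, mapBD], by rw [← mapτ', hB, mapAD]⟩)
    · exact Or.inr (Or.inl (Or.inl ⟨by rw [← mapτ, hA, mapAE], by rw [← mapτ', hB, mapBE1]⟩))
    · exact Or.inr (Or.inl (Or.inr ⟨by rw [← mapτ, hA, mapBE1], by rw [← mapτ', hB, mapAE]⟩))
    · exact Or.inr (Or.inr (Or.inl (Or.inl ⟨by rw [← mapτ, hA, mapAE], by rw [← mapτ', hB, mapBE2]⟩)))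
    · exact Or.inr (Or.inr (Or.inl (Or.inr ⟨by rw [← mapτ, hA, mapBE2], by rw [← mapτ', hB, mapAE]⟩)))
    · exact Or.inr (Or.inr (Or.inr (Or.inl (Or.inl ⟨by rw [← mapτ, hA, mapAA], by rw [← mapτ', hB, mapBA1]⟩))))
    · exact Or.inr (Or.inr (Or.inr (Or.inl (Or.inr ⟨by rw [← mapτ, hA, mapBA1], by rw [← mapτ', hB, mapAA]⟩))))
    · exact Or.inr (Or.inr (Or.inr (Or.inr (Or.inl (Or.inl ⟨by rw [← mapτ, hA, mapAA], by rw [← mapτ', hB, mapBA3]⟩)))))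
    · exact Or.inr (Or.inr (Or.inr (Or.inr (Or.inl (Or.inr ⟨by rw [← mapτ, hA, mapBA3], by rw [← mapτ', hB, mapAA]⟩)))))
    · exact Or.inr (Or.inr (Or.inr (Or.inr (Or.inr (Or.inl (Or.inl ⟨by rw [← mapτ, hA, mapAA], by rw [← mapτ', hB, mapBA2]⟩))))))
    · exact Or.inr (Or.inr (Or.inr (Or.inr (Or.inr (Or.inl (Or.inr ⟨by rw [← mapτ, hA, mapBA2], by rw [← mapτ', hB, mapAA]⟩))))))
    · exact Or.inr (Or.inr (Or.inr (Or.inr (Or.inr (Or.inr (Or.inl ⟨by rw [← mapτ, hA, mapBA3], by rw [← mapτ', hB, mapBA1]⟩))))))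
    · exact Or.inr (Or.inr (Or.inr (Or.inr (Or.inr (Or.inr (Or.inr ⟨by rw [← mapτ, hA, mapBA1], by rw [← mapτ', hB, mapBA3]⟩))))))

/-- **The arithmetic of Theorem 4's triples** (`n = m + k`, `k ≥ 4`): `2ᵐ·2ᵏ = 2ⁿ`, `2ᵐ·2 = 2ᵐ⁺¹`, `2ᵐ·3 = 3(2ᵐ)`, `2ᵐ(2ᵏ − 4) =
2ⁿ − 2ᵐ⁺²`, `2ᵐ(2ᵏ − 2) = 2ⁿ − 2ᵐ⁺¹`, `2ᵐ·2ᵏ⁻¹ = 2ⁿ⁻¹`, `2ᵐ(2ᵏ⁻¹ − 2) = 2ⁿ⁻¹ − 2ᵐ⁺¹`, `2ᵐ(2ᵏ⁻¹ − 1) = 2ⁿ⁻¹ − 2ᵐ`, `2ᵐ(2ᵏ⁻¹ + 1) =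
2ⁿ⁻¹ + 2ᵐ`, `2ᵐ(2ᵏ⁻² − 1) = 2ⁿ⁻² − 2ᵐ`, `2ᵐ(3·2ᵏ⁻² − 1) = 3(2ⁿ⁻²) − 2ᵐ` — so the previous theorem's seven pairs are K–R's d)ₘ
`((2ᵐ, 3(2ᵐ), 2ⁿ − 2ᵐ⁺²), (2ⁿ⁻¹ − 2ᵐ, 2ⁿ⁻¹ − 2ᵐ⁺¹, 3(2ᵐ)))`, e)ₘ `((2ᵐ, 2ⁿ⁻¹, 2ⁿ⁻¹ − 2ᵐ), (2ᵐ, 2ᵐ, 2ⁿ − 2ᵐ⁺¹))`, c)ₘ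
`((2ᵐ, 2ᵐ, 2ⁿ − 2ᵐ⁺¹), (2ᵐ⁺¹, 2ⁿ⁻¹ − 2ᵐ, 2ⁿ⁻¹ − 2ᵐ))`, a)ₘ `((2ᵐ, 2ⁿ⁻¹ − 2ᵐ⁺¹, 2ⁿ⁻¹ + 2ᵐ), (2ᵐ⁺¹, 2ⁿ⁻² − 2ᵐ, 3(2ⁿ⁻²) − 2ᵐ))` and the
three pairs among a)ₘ's two triples and e)ₘ₊₁'s two triples `(2ᵐ⁺¹, 2ⁿ⁻¹, 2ⁿ⁻¹ − 2ᵐ⁺¹)`, `(2ᵐ⁺¹, 2ᵐ⁺¹, 2ⁿ − 2ᵐ⁺²)` ("Furthermore"), up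
to order. [cite: KoblitzRohrlich1978, Theorem 4 (p. 1186)] -/
theorem twoPow_theoremFour_arith (hk : 4 ≤ k) :
    2 ^ m * 2 ^ k = 2 ^ (m + k) ∧ 2 ^ m * 2 = 2 ^ (m + 1) ∧ 2 ^ m * 3 = 3 * 2 ^ m ∧
      2 ^ m * (2 ^ k - 4) = 2 ^ (m + k) - 2 ^ (m + 2) ∧ 2 ^ m * (2 ^ k - 2) = 2 ^ (m + k) - 2 ^ (m + 1) ∧
      2 ^ m * 2 ^ (k - 1) = 2 ^ (m + k - 1) ∧ 2 ^ m * (2 ^ (k - 1) - 2) = 2 ^ (m + k - 1) - 2 ^ (m + 1) ∧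
      2 ^ m * (2 ^ (k - 1) - 1) = 2 ^ (m + k - 1) - 2 ^ m ∧ 2 ^ m * (2 ^ (k - 1) + 1) = 2 ^ (m + k - 1) + 2 ^ m ∧
      2 ^ m * (2 ^ (k - 2) - 1) = 2 ^ (m + k - 2) - 2 ^ m ∧ 2 ^ m * (3 * 2 ^ (k - 2) - 1) = 3 * 2 ^ (m + k - 2) - 2 ^ m := by
  have h1 : 2 ^ (m + k - 1) = 2 ^ m * 2 ^ (k - 1) := by
    rw [← pow_add]
    congr 1
    omega
  have h2 : 2 ^ (m + k - 2) = 2 ^ m * 2 ^ (k - 2) := by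
    rw [← pow_add]
    congr 1
    omega
  have h4 : 2 ^ (m + 2) = 2 ^ m * 4 := by rw [pow_add]; norm_num
  have h3 : 2 ^ (m + 1) = 2 ^ m * 2 := pow_succ 2 m
  refine ⟨(pow_add 2 m k).symm, (pow_succ 2 m).symm, mul_comm _ _, ?_, ?_, h1.symm, ?_, ?_, ?_, ?_, ?_⟩
  · rw [pow_add, h4, Nat.mul_sub]
  · rw [pow_add, h3, Nat.mul_sub]
  · rw [h1, h3, Nat.mul_sub]
  · rw [h1, Nat.mul_sub, mul_one]
  · rw [h1, mul_add, mul_one]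
  · rw [h2, Nat.mul_sub, mul_one]
  · rw [h2, Nat.mul_sub, mul_one, mul_left_comm]

/-- **THEOREM 4 AS AN EQUIVALENCE, every `m`** (level `2ᵐ·2ᵏ`, `k ≥ 4`, hypotheses as in
`perm_or_exceptional_of_fermatCMType_eq_twoPow_mul`): `H_{τ′} = H_τ` modulo `N` iff `{τ′} = {τ}` or, for a unit `w`, `(wτ, wτ′)` is one of
the seven pairs of `2ᵐ`-multiples up to order ("⟸": the seven pairs have equal `H` at level `2ᵏ` — sibling
`fermatCMType_eq_of_exceptional_pairs_twoPow` — and equal sets stay equal under the change of level, sibling `fermatCMType_level_mul_eq_of_eq`).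
[cite: KoblitzRohrlich1978, Theorem 4 (p. 1186), §5 Proposition (p. 1200), §1 (pp. 1183–1185)] -/
theorem fermatCMType_eq_iff_perm_or_exceptional_twoPow_mul [NeZero (2 ^ k)] [NeZero (2 ^ m * 2 ^ k)] (hk : 4 ≤ k)
    {r s t r' s' t' : ℕ}
    (hr : (r : ZMod (2 ^ k)) ≠ 0) (hs : (s : ZMod (2 ^ k)) ≠ 0) (ht : (t : ZMod (2 ^ k)) ≠ 0)
    (hrst : ((r + s + t : ℕ) : ZMod (2 ^ k)) = 0)
    (hr' : (r' : ZMod (2 ^ k)) ≠ 0) (hs' : (s' : ZMod (2 ^ k)) ≠ 0) (ht' : (t' : ZMod (2 ^ k)) ≠ 0)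
    (hrst' : ((r' + s' + t' : ℕ) : ZMod (2 ^ k)) = 0)
    (hunit : IsUnit (r : ZMod (2 ^ k)) ∨ IsUnit (s : ZMod (2 ^ k)) ∨ IsUnit (t : ZMod (2 ^ k)) ∨
      IsUnit (r' : ZMod (2 ^ k)) ∨ IsUnit (s' : ZMod (2 ^ k)) ∨ IsUnit (t' : ZMod (2 ^ k))) :
    fermatCMType (2 ^ m * 2 ^ k) ((2 ^ m * r' : ℕ) : ZMod (2 ^ m * 2 ^ k)) ((2 ^ m * s' : ℕ) : ZMod (2 ^ m * 2 ^ k))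
        ((2 ^ m * t' : ℕ) : ZMod (2 ^ m * 2 ^ k)) =
      fermatCMType (2 ^ m * 2 ^ k) ((2 ^ m * r : ℕ) : ZMod (2 ^ m * 2 ^ k)) ((2 ^ m * s : ℕ) : ZMod (2 ^ m * 2 ^ k))
        ((2 ^ m * t : ℕ) : ZMod (2 ^ m * 2 ^ k)) ↔
    (({((2 ^ m * r' : ℕ) : ZMod (2 ^ m * 2 ^ k)), ((2 ^ m * s' : ℕ) : ZMod (2 ^ m * 2 ^ k)), ((2 ^ m * t' : ℕ) : ZMod (2 ^ m * 2 ^ k))} :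
        Multiset (ZMod (2 ^ m * 2 ^ k))) =
      {((2 ^ m * r : ℕ) : ZMod (2 ^ m * 2 ^ k)), ((2 ^ m * s : ℕ) : ZMod (2 ^ m * 2 ^ k)), ((2 ^ m * t : ℕ) : ZMod (2 ^ m * 2 ^ k))} ∨
    ∃ w : ZMod (2 ^ m * 2 ^ k), IsUnit w ∧
      (((({w * ((2 ^ m * r : ℕ) : ZMod (2 ^ m * 2 ^ k)), w * ((2 ^ m * s : ℕ) : ZMod (2 ^ m * 2 ^ k)),
          w * ((2 ^ m * t : ℕ) : ZMod (2 ^ m * 2 ^ k))} : Multiset (ZMod (2 ^ m * 2 ^ k))) =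
          {((2 ^ m * (2 ^ k - 4) : ℕ) : ZMod (2 ^ m * 2 ^ k)), ((2 ^ m * 1 : ℕ) : ZMod (2 ^ m * 2 ^ k)),
            ((2 ^ m * 3 : ℕ) : ZMod (2 ^ m * 2 ^ k))} ∧
        ({w * ((2 ^ m * r' : ℕ) : ZMod (2 ^ m * 2 ^ k)), w * ((2 ^ m * s' : ℕ) : ZMod (2 ^ m * 2 ^ k)),
          w * ((2 ^ m * t' : ℕ) : ZMod (2 ^ m * 2 ^ k))} : Multiset (ZMod (2 ^ m * 2 ^ k))) =
          {((2 ^ m * (2 ^ (k - 1) - 2) : ℕ) : ZMod (2 ^ m * 2 ^ k)), ((2 ^ m * (2 ^ (k - 1) - 1) : ℕ) : ZMod (2 ^ m * 2 ^ k)),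
            ((2 ^ m * 3 : ℕ) : ZMod (2 ^ m * 2 ^ k))}) ∨
        (({w * ((2 ^ m * r : ℕ) : ZMod (2 ^ m * 2 ^ k)), w * ((2 ^ m * s : ℕ) : ZMod (2 ^ m * 2 ^ k)),
          w * ((2 ^ m * t : ℕ) : ZMod (2 ^ m * 2 ^ k))} : Multiset (ZMod (2 ^ m * 2 ^ k))) =
          {((2 ^ m * (2 ^ (k - 1) - 2) : ℕ) : ZMod (2 ^ m * 2 ^ k)), ((2 ^ m * (2 ^ (k - 1) - 1) : ℕ) : ZMod (2 ^ m * 2 ^ k)),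
            ((2 ^ m * 3 : ℕ) : ZMod (2 ^ m * 2 ^ k))} ∧
        ({w * ((2 ^ m * r' : ℕ) : ZMod (2 ^ m * 2 ^ k)), w * ((2 ^ m * s' : ℕ) : ZMod (2 ^ m * 2 ^ k)),
          w * ((2 ^ m * t' : ℕ) : ZMod (2 ^ m * 2 ^ k))} : Multiset (ZMod (2 ^ m * 2 ^ k))) =
          {((2 ^ m * (2 ^ k - 4) : ℕ) : ZMod (2 ^ m * 2 ^ k)), ((2 ^ m * 1 : ℕ) : ZMod (2 ^ m * 2 ^ k)),
            ((2 ^ m * 3 : ℕ) : ZMod (2 ^ m * 2 ^ k))})) ∨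
      ((({w * ((2 ^ m * r : ℕ) : ZMod (2 ^ m * 2 ^ k)), w * ((2 ^ m * s : ℕ) : ZMod (2 ^ m * 2 ^ k)),
          w * ((2 ^ m * t : ℕ) : ZMod (2 ^ m * 2 ^ k))} : Multiset (ZMod (2 ^ m * 2 ^ k))) =
          {((2 ^ m * (2 ^ k - 2) : ℕ) : ZMod (2 ^ m * 2 ^ k)), ((2 ^ m * 1 : ℕ) : ZMod (2 ^ m * 2 ^ k)),
            ((2 ^ m * 1 : ℕ) : ZMod (2 ^ m * 2 ^ k))} ∧
        ({w * ((2 ^ m * r' : ℕ) : ZMod (2 ^ m * 2 ^ k)), w * ((2 ^ m * s' : ℕ) : ZMod (2 ^ m * 2 ^ k)),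
          w * ((2 ^ m * t' : ℕ) : ZMod (2 ^ m * 2 ^ k))} : Multiset (ZMod (2 ^ m * 2 ^ k))) =
          {((2 ^ m * 2 ^ (k - 1) : ℕ) : ZMod (2 ^ m * 2 ^ k)), ((2 ^ m * 1 : ℕ) : ZMod (2 ^ m * 2 ^ k)),
            ((2 ^ m * (2 ^ (k - 1) - 1) : ℕ) : ZMod (2 ^ m * 2 ^ k))}) ∨
        (({w * ((2 ^ m * r : ℕ) : ZMod (2 ^ m * 2 ^ k)), w * ((2 ^ m * s : ℕ) : ZMod (2 ^ m * 2 ^ k)),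
          w * ((2 ^ m * t : ℕ) : ZMod (2 ^ m * 2 ^ k))} : Multiset (ZMod (2 ^ m * 2 ^ k))) =
          {((2 ^ m * 2 ^ (k - 1) : ℕ) : ZMod (2 ^ m * 2 ^ k)), ((2 ^ m * 1 : ℕ) : ZMod (2 ^ m * 2 ^ k)),
            ((2 ^ m * (2 ^ (k - 1) - 1) : ℕ) : ZMod (2 ^ m * 2 ^ k))} ∧
        ({w * ((2 ^ m * r' : ℕ) : ZMod (2 ^ m * 2 ^ k)), w * ((2 ^ m * s' : ℕ) : ZMod (2 ^ m * 2 ^ k)),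
          w * ((2 ^ m * t' : ℕ) : ZMod (2 ^ m * 2 ^ k))} : Multiset (ZMod (2 ^ m * 2 ^ k))) =
          {((2 ^ m * (2 ^ k - 2) : ℕ) : ZMod (2 ^ m * 2 ^ k)), ((2 ^ m * 1 : ℕ) : ZMod (2 ^ m * 2 ^ k)),
            ((2 ^ m * 1 : ℕ) : ZMod (2 ^ m * 2 ^ k))})) ∨
      ((({w * ((2 ^ m * r : ℕ) : ZMod (2 ^ m * 2 ^ k)), w * ((2 ^ m * s : ℕ) : ZMod (2 ^ m * 2 ^ k)),
          w * ((2 ^ m * t : ℕ) : ZMod (2 ^ m * 2 ^ k))} : Multiset (ZMod (2 ^ m * 2 ^ k))) =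
          {((2 ^ m * (2 ^ k - 2) : ℕ) : ZMod (2 ^ m * 2 ^ k)), ((2 ^ m * 1 : ℕ) : ZMod (2 ^ m * 2 ^ k)),
            ((2 ^ m * 1 : ℕ) : ZMod (2 ^ m * 2 ^ k))} ∧
        ({w * ((2 ^ m * r' : ℕ) : ZMod (2 ^ m * 2 ^ k)), w * ((2 ^ m * s' : ℕ) : ZMod (2 ^ m * 2 ^ k)),
          w * ((2 ^ m * t' : ℕ) : ZMod (2 ^ m * 2 ^ k))} : Multiset (ZMod (2 ^ m * 2 ^ k))) =
          {((2 ^ m * 2 : ℕ) : ZMod (2 ^ m * 2 ^ k)), ((2 ^ m * (2 ^ (k - 1) - 1) : ℕ) : ZMod (2 ^ m * 2 ^ k)),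
            ((2 ^ m * (2 ^ (k - 1) - 1) : ℕ) : ZMod (2 ^ m * 2 ^ k))}) ∨
        (({w * ((2 ^ m * r : ℕ) : ZMod (2 ^ m * 2 ^ k)), w * ((2 ^ m * s : ℕ) : ZMod (2 ^ m * 2 ^ k)),
          w * ((2 ^ m * t : ℕ) : ZMod (2 ^ m * 2 ^ k))} : Multiset (ZMod (2 ^ m * 2 ^ k))) =
          {((2 ^ m * 2 : ℕ) : ZMod (2 ^ m * 2 ^ k)), ((2 ^ m * (2 ^ (k - 1) - 1) : ℕ) : ZMod (2 ^ m * 2 ^ k)),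
            ((2 ^ m * (2 ^ (k - 1) - 1) : ℕ) : ZMod (2 ^ m * 2 ^ k))} ∧
        ({w * ((2 ^ m * r' : ℕ) : ZMod (2 ^ m * 2 ^ k)), w * ((2 ^ m * s' : ℕ) : ZMod (2 ^ m * 2 ^ k)),
          w * ((2 ^ m * t' : ℕ) : ZMod (2 ^ m * 2 ^ k))} : Multiset (ZMod (2 ^ m * 2 ^ k))) =
          {((2 ^ m * (2 ^ k - 2) : ℕ) : ZMod (2 ^ m * 2 ^ k)), ((2 ^ m * 1 : ℕ) : ZMod (2 ^ m * 2 ^ k)),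
            ((2 ^ m * 1 : ℕ) : ZMod (2 ^ m * 2 ^ k))})) ∨
      ((({w * ((2 ^ m * r : ℕ) : ZMod (2 ^ m * 2 ^ k)), w * ((2 ^ m * s : ℕ) : ZMod (2 ^ m * 2 ^ k)),
          w * ((2 ^ m * t : ℕ) : ZMod (2 ^ m * 2 ^ k))} : Multiset (ZMod (2 ^ m * 2 ^ k))) =
          {((2 ^ m * (2 ^ (k - 1) - 2) : ℕ) : ZMod (2 ^ m * 2 ^ k)), ((2 ^ m * 1 : ℕ) : ZMod (2 ^ m * 2 ^ k)),
            ((2 ^ m * (2 ^ (k - 1) + 1) : ℕ) : ZMod (2 ^ m * 2 ^ k))} ∧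
        ({w * ((2 ^ m * r' : ℕ) : ZMod (2 ^ m * 2 ^ k)), w * ((2 ^ m * s' : ℕ) : ZMod (2 ^ m * 2 ^ k)),
          w * ((2 ^ m * t' : ℕ) : ZMod (2 ^ m * 2 ^ k))} : Multiset (ZMod (2 ^ m * 2 ^ k))) =
          {((2 ^ m * (2 ^ k - 4) : ℕ) : ZMod (2 ^ m * 2 ^ k)), ((2 ^ m * 2 : ℕ) : ZMod (2 ^ m * 2 ^ k)),
            ((2 ^ m * 2 : ℕ) : ZMod (2 ^ m * 2 ^ k))}) ∨
        (({w * ((2 ^ m * r : ℕ) : ZMod (2 ^ m * 2 ^ k)), w * ((2 ^ m * s : ℕ) : ZMod (2 ^ m * 2 ^ k)),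
          w * ((2 ^ m * t : ℕ) : ZMod (2 ^ m * 2 ^ k))} : Multiset (ZMod (2 ^ m * 2 ^ k))) =
          {((2 ^ m * (2 ^ k - 4) : ℕ) : ZMod (2 ^ m * 2 ^ k)), ((2 ^ m * 2 : ℕ) : ZMod (2 ^ m * 2 ^ k)),
            ((2 ^ m * 2 : ℕ) : ZMod (2 ^ m * 2 ^ k))} ∧
        ({w * ((2 ^ m * r' : ℕ) : ZMod (2 ^ m * 2 ^ k)), w * ((2 ^ m * s' : ℕ) : ZMod (2 ^ m * 2 ^ k)),
          w * ((2 ^ m * t' : ℕ) : ZMod (2 ^ m * 2 ^ k))} : Multiset (ZMod (2 ^ m * 2 ^ k))) =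
          {((2 ^ m * (2 ^ (k - 1) - 2) : ℕ) : ZMod (2 ^ m * 2 ^ k)), ((2 ^ m * 1 : ℕ) : ZMod (2 ^ m * 2 ^ k)),
            ((2 ^ m * (2 ^ (k - 1) + 1) : ℕ) : ZMod (2 ^ m * 2 ^ k))})) ∨
      ((({w * ((2 ^ m * r : ℕ) : ZMod (2 ^ m * 2 ^ k)), w * ((2 ^ m * s : ℕ) : ZMod (2 ^ m * 2 ^ k)),
          w * ((2 ^ m * t : ℕ) : ZMod (2 ^ m * 2 ^ k))} : Multiset (ZMod (2 ^ m * 2 ^ k))) =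
          {((2 ^ m * (2 ^ (k - 1) - 2) : ℕ) : ZMod (2 ^ m * 2 ^ k)), ((2 ^ m * 1 : ℕ) : ZMod (2 ^ m * 2 ^ k)),
            ((2 ^ m * (2 ^ (k - 1) + 1) : ℕ) : ZMod (2 ^ m * 2 ^ k))} ∧
        ({w * ((2 ^ m * r' : ℕ) : ZMod (2 ^ m * 2 ^ k)), w * ((2 ^ m * s' : ℕ) : ZMod (2 ^ m * 2 ^ k)),
          w * ((2 ^ m * t' : ℕ) : ZMod (2 ^ m * 2 ^ k))} : Multiset (ZMod (2 ^ m * 2 ^ k))) =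
          {((2 ^ m * 2 : ℕ) : ZMod (2 ^ m * 2 ^ k)), ((2 ^ m * (2 ^ (k - 2) - 1) : ℕ) : ZMod (2 ^ m * 2 ^ k)),
            ((2 ^ m * (3 * 2 ^ (k - 2) - 1) : ℕ) : ZMod (2 ^ m * 2 ^ k))}) ∨
        (({w * ((2 ^ m * r : ℕ) : ZMod (2 ^ m * 2 ^ k)), w * ((2 ^ m * s : ℕ) : ZMod (2 ^ m * 2 ^ k)),
          w * ((2 ^ m * t : ℕ) : ZMod (2 ^ m * 2 ^ k))} : Multiset (ZMod (2 ^ m * 2 ^ k))) =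
          {((2 ^ m * 2 : ℕ) : ZMod (2 ^ m * 2 ^ k)), ((2 ^ m * (2 ^ (k - 2) - 1) : ℕ) : ZMod (2 ^ m * 2 ^ k)),
            ((2 ^ m * (3 * 2 ^ (k - 2) - 1) : ℕ) : ZMod (2 ^ m * 2 ^ k))} ∧
        ({w * ((2 ^ m * r' : ℕ) : ZMod (2 ^ m * 2 ^ k)), w * ((2 ^ m * s' : ℕ) : ZMod (2 ^ m * 2 ^ k)),
          w * ((2 ^ m * t' : ℕ) : ZMod (2 ^ m * 2 ^ k))} : Multiset (ZMod (2 ^ m * 2 ^ k))) =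
          {((2 ^ m * (2 ^ (k - 1) - 2) : ℕ) : ZMod (2 ^ m * 2 ^ k)), ((2 ^ m * 1 : ℕ) : ZMod (2 ^ m * 2 ^ k)),
            ((2 ^ m * (2 ^ (k - 1) + 1) : ℕ) : ZMod (2 ^ m * 2 ^ k))})) ∨
      ((({w * ((2 ^ m * r : ℕ) : ZMod (2 ^ m * 2 ^ k)), w * ((2 ^ m * s : ℕ) : ZMod (2 ^ m * 2 ^ k)),
          w * ((2 ^ m * t : ℕ) : ZMod (2 ^ m * 2 ^ k))} : Multiset (ZMod (2 ^ m * 2 ^ k))) =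
          {((2 ^ m * (2 ^ (k - 1) - 2) : ℕ) : ZMod (2 ^ m * 2 ^ k)), ((2 ^ m * 1 : ℕ) : ZMod (2 ^ m * 2 ^ k)),
            ((2 ^ m * (2 ^ (k - 1) + 1) : ℕ) : ZMod (2 ^ m * 2 ^ k))} ∧
        ({w * ((2 ^ m * r' : ℕ) : ZMod (2 ^ m * 2 ^ k)), w * ((2 ^ m * s' : ℕ) : ZMod (2 ^ m * 2 ^ k)),
          w * ((2 ^ m * t' : ℕ) : ZMod (2 ^ m * 2 ^ k))} : Multiset (ZMod (2 ^ m * 2 ^ k))) =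
          {((2 ^ m * 2 ^ (k - 1) : ℕ) : ZMod (2 ^ m * 2 ^ k)), ((2 ^ m * 2 : ℕ) : ZMod (2 ^ m * 2 ^ k)),
            ((2 ^ m * (2 ^ (k - 1) - 2) : ℕ) : ZMod (2 ^ m * 2 ^ k))}) ∨
        (({w * ((2 ^ m * r : ℕ) : ZMod (2 ^ m * 2 ^ k)), w * ((2 ^ m * s : ℕ) : ZMod (2 ^ m * 2 ^ k)),
          w * ((2 ^ m * t : ℕ) : ZMod (2 ^ m * 2 ^ k))} : Multiset (ZMod (2 ^ m * 2 ^ k))) =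
          {((2 ^ m * 2 ^ (k - 1) : ℕ) : ZMod (2 ^ m * 2 ^ k)), ((2 ^ m * 2 : ℕ) : ZMod (2 ^ m * 2 ^ k)),
            ((2 ^ m * (2 ^ (k - 1) - 2) : ℕ) : ZMod (2 ^ m * 2 ^ k))} ∧
        ({w * ((2 ^ m * r' : ℕ) : ZMod (2 ^ m * 2 ^ k)), w * ((2 ^ m * s' : ℕ) : ZMod (2 ^ m * 2 ^ k)),
          w * ((2 ^ m * t' : ℕ) : ZMod (2 ^ m * 2 ^ k))} : Multiset (ZMod (2 ^ m * 2 ^ k))) =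
          {((2 ^ m * (2 ^ (k - 1) - 2) : ℕ) : ZMod (2 ^ m * 2 ^ k)), ((2 ^ m * 1 : ℕ) : ZMod (2 ^ m * 2 ^ k)),
            ((2 ^ m * (2 ^ (k - 1) + 1) : ℕ) : ZMod (2 ^ m * 2 ^ k))})) ∨
      ((({w * ((2 ^ m * r : ℕ) : ZMod (2 ^ m * 2 ^ k)), w * ((2 ^ m * s : ℕ) : ZMod (2 ^ m * 2 ^ k)),
          w * ((2 ^ m * t : ℕ) : ZMod (2 ^ m * 2 ^ k))} : Multiset (ZMod (2 ^ m * 2 ^ k))) =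
          {((2 ^ m * 2 : ℕ) : ZMod (2 ^ m * 2 ^ k)), ((2 ^ m * (2 ^ (k - 2) - 1) : ℕ) : ZMod (2 ^ m * 2 ^ k)),
            ((2 ^ m * (3 * 2 ^ (k - 2) - 1) : ℕ) : ZMod (2 ^ m * 2 ^ k))} ∧
        ({w * ((2 ^ m * r' : ℕ) : ZMod (2 ^ m * 2 ^ k)), w * ((2 ^ m * s' : ℕ) : ZMod (2 ^ m * 2 ^ k)),
          w * ((2 ^ m * t' : ℕ) : ZMod (2 ^ m * 2 ^ k))} : Multiset (ZMod (2 ^ m * 2 ^ k))) =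
          {((2 ^ m * (2 ^ k - 4) : ℕ) : ZMod (2 ^ m * 2 ^ k)), ((2 ^ m * 2 : ℕ) : ZMod (2 ^ m * 2 ^ k)),
            ((2 ^ m * 2 : ℕ) : ZMod (2 ^ m * 2 ^ k))}) ∨
        (({w * ((2 ^ m * r : ℕ) : ZMod (2 ^ m * 2 ^ k)), w * ((2 ^ m * s : ℕ) : ZMod (2 ^ m * 2 ^ k)),
          w * ((2 ^ m * t : ℕ) : ZMod (2 ^ m * 2 ^ k))} : Multiset (ZMod (2 ^ m * 2 ^ k))) =
          {((2 ^ m * (2 ^ k - 4) : ℕ) : ZMod (2 ^ m * 2 ^ k)), ((2 ^ m * 2 : ℕ) : ZMod (2 ^ m * 2 ^ k)),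
            ((2 ^ m * 2 : ℕ) : ZMod (2 ^ m * 2 ^ k))} ∧
        ({w * ((2 ^ m * r' : ℕ) : ZMod (2 ^ m * 2 ^ k)), w * ((2 ^ m * s' : ℕ) : ZMod (2 ^ m * 2 ^ k)),
          w * ((2 ^ m * t' : ℕ) : ZMod (2 ^ m * 2 ^ k))} : Multiset (ZMod (2 ^ m * 2 ^ k))) =
          {((2 ^ m * 2 : ℕ) : ZMod (2 ^ m * 2 ^ k)), ((2 ^ m * (2 ^ (k - 2) - 1) : ℕ) : ZMod (2 ^ m * 2 ^ k)),
            ((2 ^ m * (3 * 2 ^ (k - 2) - 1) : ℕ) : ZMod (2 ^ m * 2 ^ k))})))) := by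
  refine ⟨perm_or_exceptional_of_fermatCMType_eq_twoPow_mul hk hr hs ht hrst hr' hs' ht' hrst' hunit, ?_⟩
  have hd : 0 < 2 ^ m := pow_pos (by norm_num) m
  -- the seven pairs at level `2ᵏ`, entries as natural numbers, pulled back to level `2ᵐ2ᵏ`
  have P := fermatCMType_eq_of_exceptional_pairs_twoPow (n := k) (by omega)
  obtain ⟨eM4, eM2, eP1, eP1m2, eP1m1, eP1p1, eP2m1, eP2x3m1, eOne, eTwo, eThree⟩ := natCast_exceptional_entries_twoPow hk
  rw [eP2x3m1, eP2m1, eP1m2, eP1m1, eP1p1, eP1, eM4, eM2, eThree, eTwo, eOne] at P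
  obtain ⟨P₁, P₂, P₃, P₄, P₅, P₆, P₇⟩ := P
  have Q₁ := fermatCMType_level_mul_eq_of_eq (M := 2 ^ k) hd P₁
  have Q₂ := fermatCMType_level_mul_eq_of_eq (M := 2 ^ k) hd P₂
  have Q₃ := fermatCMType_level_mul_eq_of_eq (M := 2 ^ k) hd P₃
  have Q₄ := fermatCMType_level_mul_eq_of_eq (M := 2 ^ k) hd P₄
  have Q₅ := fermatCMType_level_mul_eq_of_eq (M := 2 ^ k) hd P₅
  have Q₆ := fermatCMType_level_mul_eq_of_eq (M := 2 ^ k) hd P₆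
  have Q₇ := fermatCMType_level_mul_eq_of_eq (M := 2 ^ k) hd P₇
  rintro (hperm | ⟨w, hw, hK⟩)
  · exact fermatCMType_eq_of_multiset_eq hperm
  · rcases hK with (⟨hτ, hτ'⟩ | ⟨hτ, hτ'⟩) | (⟨hτ, hτ'⟩ | ⟨hτ, hτ'⟩) | (⟨hτ, hτ'⟩ | ⟨hτ, hτ'⟩) | (⟨hτ, hτ'⟩ | ⟨hτ, hτ'⟩) |
      (⟨hτ, hτ'⟩ | ⟨hτ, hτ'⟩) | (⟨hτ, hτ'⟩ | ⟨hτ, hτ'⟩) | (⟨hτ, hτ'⟩ | ⟨hτ, hτ'⟩)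
    · exact (fermatCMType_mul_eq_mul_iff hw).1
        ((fermatCMType_eq_of_multiset_eq hτ').trans ((Q₁).trans (fermatCMType_eq_of_multiset_eq hτ).symm))
    · exact (fermatCMType_mul_eq_mul_iff hw).1
        ((fermatCMType_eq_of_multiset_eq hτ').trans ((Q₁).symm.trans (fermatCMType_eq_of_multiset_eq hτ).symm))
    · exact (fermatCMType_mul_eq_mul_iff hw).1
        ((fermatCMType_eq_of_multiset_eq hτ').trans ((Q₂).trans (fermatCMType_eq_of_multiset_eq hτ).symm))
    · exact (fermatCMType_mul_eq_mul_iff hw).1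
        ((fermatCMType_eq_of_multiset_eq hτ').trans ((Q₂).symm.trans (fermatCMType_eq_of_multiset_eq hτ).symm))
    · exact (fermatCMType_mul_eq_mul_iff hw).1
        ((fermatCMType_eq_of_multiset_eq hτ').trans ((Q₃).trans (fermatCMType_eq_of_multiset_eq hτ).symm))
    · exact (fermatCMType_mul_eq_mul_iff hw).1
        ((fermatCMType_eq_of_multiset_eq hτ').trans ((Q₃).symm.trans (fermatCMType_eq_of_multiset_eq hτ).symm))
    · exact (fermatCMType_mul_eq_mul_iff hw).1
        ((fermatCMType_eq_of_multiset_eq hτ').trans ((Q₄).trans (fermatCMType_eq_of_multiset_eq hτ).symm))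
    · exact (fermatCMType_mul_eq_mul_iff hw).1
        ((fermatCMType_eq_of_multiset_eq hτ').trans ((Q₄).symm.trans (fermatCMType_eq_of_multiset_eq hτ).symm))
    · exact (fermatCMType_mul_eq_mul_iff hw).1
        ((fermatCMType_eq_of_multiset_eq hτ').trans ((Q₅).trans (fermatCMType_eq_of_multiset_eq hτ).symm))
    · exact (fermatCMType_mul_eq_mul_iff hw).1
        ((fermatCMType_eq_of_multiset_eq hτ').trans ((Q₅).symm.trans (fermatCMType_eq_of_multiset_eq hτ).symm))
    · exact (fermatCMType_mul_eq_mul_iff hw).1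
        ((fermatCMType_eq_of_multiset_eq hτ').trans ((Q₆).trans (fermatCMType_eq_of_multiset_eq hτ).symm))
    · exact (fermatCMType_mul_eq_mul_iff hw).1
        ((fermatCMType_eq_of_multiset_eq hτ').trans ((Q₆).symm.trans (fermatCMType_eq_of_multiset_eq hτ).symm))
    · exact (fermatCMType_mul_eq_mul_iff hw).1
        ((fermatCMType_eq_of_multiset_eq hτ').trans ((Q₇).trans (fermatCMType_eq_of_multiset_eq hτ).symm))
    · exact (fermatCMType_mul_eq_mul_iff hw).1
        ((fermatCMType_eq_of_multiset_eq hτ').trans ((Q₇).symm.trans (fermatCMType_eq_of_multiset_eq hτ).symm))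

end TheoremFour

end CyclotomicFermatCMType

end Literature.AlgebraicGeometry.ComplexMultiplication
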